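import Literature.MathematicalPhysics.QuantumFieldTheory.QCDWickMinorMeasurability
import HarnessLib

/-!
# Lower bounds on the diagonal of the Wilson quark propagator at positive bare mass

Topic `Literature/MathematicalPhysics/QuantumFieldTheory`; namespace
`Literature.MathematicalPhysics.QuantumFieldTheory`.  The LOWER companion of the hopping-expansion
upper bounds of `WilsonPropagatorHeavyMass.lean` / `QCDHeavyQuarkPropagator.lean`.

* §1 (one flavour, any unitary colour representation `ρ`, any periodic four-torus, any gauge field,
  Wilson parameter `r = 1`): the numerical range of the Wilson–Dirac operator lies in `Re ≥ m`
  (`re_quadForm_wilsonDirac_ge_mass`: `D_W = (m+4)·1 − Σ_μ W_μ` with `‖W_μ‖ ≤ 1`), whence for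
  `m > 0` every DIAGONAL entry of the propagator obeys `m/(m+8)² ≤ Re (D_W⁻¹)_{ee}`
  (`re_inv_wilsonDirac_apply_self_ge`: numerical range at the column `ψ = D_W⁻¹ e` plus the
  operator-norm bound `‖D_W‖ ≤ m + 8`), and the same-site colour–spin block sum is `≥ 4N·m/(m+8)²`
  (`diag_blockSum_norm_inv_wilsonDirac_ge`).
* §2 (`N_f` flavours, `SU(3)`, the tree's `diracMatrix`): integrating §1 against the positive
  `|det|`-weight gives the phase-quenched bound `(12 m_f/(m_f+8)²)^s ≤ E_{|w|,β,S}[(Σ|G_f(0,0)|)^s]`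
  for all positive bare masses, every coupling, volume and exponent `s ≥ 0`
  (`phaseQuenched_diagMoment_ge_of_pos`).

Standard facts (numerical-range argument for `m + A` with `Re A ≥ 0`); written for the harness by a
stub-worker of prover-line-stmt-QuantumFields-11513-0 (crux `OneScaleTrajectory`, 2026-08-16), where they
certify that the `n = 0` entry of the crux's lower pin (iii) is free at positive bare masses.
Not here: anything at bare mass `≤ 0` (the numerical range then contains `0`), off-diagonal entries.
-/

noncomputable section

namespace Literature.MathematicalPhysics.QuantumFieldTheory

open scoped BigOperators Topology ComplexConjugate
open MeasureTheory Filter Set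
open Literature.MathematicalPhysics.QuantumLattice Literature.Probability.LatticeModels

/-! ### §1 Numerical range of the Wilson–Dirac operator and the diagonal of the propagator -/

section Torus

variable {L N : ℕ} [NeZero L] {G : Type*} [Group G] (ρ : G →* Matrix (Fin N) (Fin N) ℂ)

open Matrix
open scoped Matrix.Norms.L2Operator

/-- Termwise polarisation bound: `Re(conj a · b) ≤ (‖a‖² + ‖b‖²)/2`. [folklore] -/
theorem re_conj_mul_le_half (a b : ℂ) : (conj a * b).re ≤ (‖a‖ ^ 2 + ‖b‖ ^ 2) / 2 := by
  -- adapted from Summit.QuantumFields.QCD.Theorems.EarlyCrosserLawNegative.re_conj_mul_le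
  rw [Complex.sq_norm, Complex.sq_norm, Complex.normSq_apply, Complex.normSq_apply]
  simp only [Complex.mul_re, Complex.conj_re, Complex.conj_im]
  nlinarith [sq_nonneg (a.re - b.re), sq_nonneg (a.im - b.im)]

/-- For a matrix of `ℓ²` operator norm `≤ 1`: `Re Σ_i conj(v i) (W v)_i ≤ Σ_i ‖v i‖²`. [folklore] -/
theorem re_sum_conj_mul_mulVec_le_of_opNorm_le_one
    (W : Matrix (TorusSite 4 L × Fin N × Fin 4) (TorusSite 4 L × Fin N × Fin 4) ℂ)
    (hW : ‖W‖ ≤ 1) (v : TorusSite 4 L × Fin N × Fin 4 → ℂ) :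
    (∑ i, conj (v i) * (W *ᵥ v) i).re ≤ ∑ i, ‖v i‖ ^ 2 := by
  -- adapted from Summit.QuantumFields.QCD.Theorems.EarlyCrosserLawNegative.re_sum_conj_mul_mulVec_le
  have h1 : ∑ i, ‖(W *ᵥ v) i‖ ^ 2 ≤ ∑ i, ‖v i‖ ^ 2 := by
    refine (sum_norm_sq_mulVec_le W v).trans ?_
    have h0 : 0 ≤ ∑ i, ‖v i‖ ^ 2 := Finset.sum_nonneg fun i _ => by positivity
    have : ‖W‖ ^ 2 ≤ 1 := by nlinarith [norm_nonneg W]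
    nlinarith
  rw [Complex.re_sum]
  have h2 : ∑ i, (conj (v i) * (W *ᵥ v) i).re ≤ ∑ i, (‖v i‖ ^ 2 + ‖(W *ᵥ v) i‖ ^ 2) / 2 :=
    Finset.sum_le_sum fun i _ => re_conj_mul_le_half _ _
  have h3 : ∑ i, (‖v i‖ ^ 2 + ‖(W *ᵥ v) i‖ ^ 2) / 2 =
      ((∑ i, ‖v i‖ ^ 2) + ∑ i, ‖(W *ᵥ v) i‖ ^ 2) / 2 := by
    rw [← Finset.sum_div, Finset.sum_add_distrib]
  linarith

/-- **Numerical range of the Wilson–Dirac operator** (`r = 1`, unitary colour representation, any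
periodic four-torus, any gauge field, any real bare mass `m`): `m Σ_i‖v i‖² ≤ Re Σ_i conj(v i)(D_W v)_i`
— the hermitian part of the massless operator is the covariant Wilson Laplacian `≥ 0`; here from
`D_W = (m+4)·1 - Σ_μ W_μ` (`wilsonDirac_eq_sub_sum_wilsonHop`) and `‖W_μ‖ ≤ 1`. [folklore] -/
theorem re_quadForm_wilsonDirac_ge_mass (hρ : ∀ g, ρ g ∈ Matrix.unitaryGroup (Fin N) ℂ)
    (U : GaugeConfig 4 L G) (m : ℝ) (v : TorusSite 4 L × Fin N × Fin 4 → ℂ) :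
    m * ∑ i, ‖v i‖ ^ 2 ≤ (∑ i, conj (v i) * (wilsonDirac ρ U m 1 *ᵥ v) i).re := by
  -- adapted from Summit.QuantumFields.QCD.Theorems.EarlyCrosserLawNegative.re_quadForm_wilsonDirac_ge
  rw [wilsonDirac_eq_sub_sum_wilsonHop ρ hρ U m, Matrix.sub_mulVec, Matrix.smul_mulVec,
    Matrix.one_mulVec, Matrix.sum_mulVec]
  have hdiag : (∑ i, conj (v i) * ((((m + 4 : ℝ) : ℂ) • v) i)).re = (m + 4) * ∑ i, ‖v i‖ ^ 2 := by
    rw [Complex.re_sum, Finset.mul_sum]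
    refine Finset.sum_congr rfl fun i _ => ?_
    rw [Pi.smul_apply, smul_eq_mul, mul_left_comm, Complex.re_ofReal_mul, Complex.conj_mul',
      ← Complex.ofReal_pow, Complex.ofReal_re]
  have hsum : ∀ μ : Fin 4, (∑ i, conj (v i) * (wilsonHop ρ U μ *ᵥ v) i).re ≤ ∑ i, ‖v i‖ ^ 2 :=
    fun μ => re_sum_conj_mul_mulVec_le_of_opNorm_le_one (wilsonHop ρ U μ)
      (l2_opNorm_wilsonHop_le ρ hρ U μ) v
  have hexp : (∑ i, conj (v i) * ((((m + 4 : ℝ) : ℂ) • v) - ∑ μ, wilsonHop ρ U μ *ᵥ v) i) =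
      (∑ i, conj (v i) * ((((m + 4 : ℝ) : ℂ) • v) i)) -
        ∑ μ, ∑ i, conj (v i) * (wilsonHop ρ U μ *ᵥ v) i := by
    rw [Finset.sum_comm, ← Finset.sum_sub_distrib]
    refine Finset.sum_congr rfl fun i _ => ?_
    rw [Pi.sub_apply, Finset.sum_apply, mul_sub, Finset.mul_sum]
  rw [hexp, Complex.sub_re, hdiag, Complex.re_sum]
  have h4 : ∑ μ : Fin 4, (∑ i, conj (v i) * (wilsonHop ρ U μ *ᵥ v) i).re ≤
      ∑ _μ : Fin 4, ∑ i, ‖v i‖ ^ 2 := Finset.sum_le_sum fun μ _ => hsum μ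
  have h4' : ∑ _μ : Fin 4, ∑ i, ‖v i‖ ^ 2 = 4 * ∑ i, ‖v i‖ ^ 2 := by simp
  linarith

/-- **Configuration-wise lower bound on the diagonal of the Wilson quark propagator at positive bare
mass.** For unitary `ρ`, every periodic four-torus, every gauge field `U`, every `m > 0` and every
index `e`: `m/(m+8)² ≤ Re (D_W(U,m,1)⁻¹)_{ee}`.  Proof: with `ψ := D_W⁻¹ e` (the `e`-th column),
`D_W ψ = δ_e`, so `Re G_{ee} = Re⟨ψ, D_W ψ⟩ ≥ m Σ‖ψ_i‖²` (numerical range) and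
`1 = Σ‖(D_Wψ)_i‖² ≤ ‖D_W‖² Σ‖ψ_i‖²` with `‖D_W‖ ≤ |m+4| + 4 = m + 8` (HJL (2.14)). [folklore] -/
theorem re_inv_wilsonDirac_apply_self_ge (hρ : ∀ g, ρ g ∈ Matrix.unitaryGroup (Fin N) ℂ)
    (U : GaugeConfig 4 L G) {m : ℝ} (hm : 0 < m) (e : TorusSite 4 L × Fin N × Fin 4) :
    m / (m + 8) ^ 2 ≤ ((wilsonDirac ρ U m 1)⁻¹ e e).re := by
  have hdet : (wilsonDirac ρ U m 1).det ≠ 0 := wilsonDirac_det_ne_zero_of_pos ρ hρ U hm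
  -- the `e`-th column of the propagator
  set ψ : TorusSite 4 L × Fin N × Fin 4 → ℂ := fun i => (wilsonDirac ρ U m 1)⁻¹ i e with hψdef
  have hcol : (wilsonDirac ρ U m 1)⁻¹ *ᵥ Pi.single e 1 = ψ := by
    rw [Matrix.mulVec_single_one]
    rfl
  have hWψ : wilsonDirac ρ U m 1 *ᵥ ψ = Pi.single e 1 := by
    rw [← hcol, Matrix.mulVec_mulVec, Matrix.mul_nonsing_inv _ (isUnit_iff_ne_zero.2 hdet),
      Matrix.one_mulVec]
  -- numerical range at `ψ`
  have hnr := re_quadForm_wilsonDirac_ge_mass ρ hρ U m ψ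
  rw [hWψ] at hnr
  have hform : (∑ i, conj (ψ i) * (Pi.single e (1 : ℂ) : TorusSite 4 L × Fin N × Fin 4 → ℂ) i) =
      conj (ψ e) := by
    rw [Finset.sum_eq_single e]
    · simp
    · intro i _ hi
      simp [hi]
    · intro h
      exact absurd (Finset.mem_univ e) h
  rw [hform, Complex.conj_re] at hnr
  -- size of the column
  have hn := sum_norm_sq_mulVec_le (wilsonDirac ρ U m 1) ψ
  rw [hWψ] at hn
  have h1 : ∑ i, ‖(Pi.single e (1 : ℂ) : TorusSite 4 L × Fin N × Fin 4 → ℂ) i‖ ^ 2 = 1 := by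
    rw [Finset.sum_eq_single e]
    · simp
    · intro i _ hi
      simp [hi]
    · intro h
      exact absurd (Finset.mem_univ e) h
  rw [h1] at hn
  have hWn : ‖wilsonDirac ρ U m 1‖ ≤ m + 8 := by
    have h := l2_opNorm_wilsonDirac_le ρ hρ U m
    rw [abs_of_pos (by linarith : (0 : ℝ) < m + 4)] at h
    linarith
  have hS0 : 0 ≤ ∑ i, ‖ψ i‖ ^ 2 := Finset.sum_nonneg fun i _ => by positivity
  have hW2 : ‖wilsonDirac ρ U m 1‖ ^ 2 ≤ (m + 8) ^ 2 := pow_le_pow_left₀ (norm_nonneg _) hWn 2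
  have hm8 : (0 : ℝ) < (m + 8) ^ 2 := by positivity
  have hS : 1 / (m + 8) ^ 2 ≤ ∑ i, ‖ψ i‖ ^ 2 := by
    rw [div_le_iff₀ hm8]
    calc (1 : ℝ) ≤ ‖wilsonDirac ρ U m 1‖ ^ 2 * ∑ i, ‖ψ i‖ ^ 2 := hn
      _ ≤ (m + 8) ^ 2 * ∑ i, ‖ψ i‖ ^ 2 := mul_le_mul_of_nonneg_right hW2 hS0
      _ = (∑ i, ‖ψ i‖ ^ 2) * (m + 8) ^ 2 := mul_comm _ _
  calc m / (m + 8) ^ 2 = m * (1 / (m + 8) ^ 2) := by ring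
    _ ≤ m * ∑ i, ‖ψ i‖ ^ 2 := mul_le_mul_of_nonneg_left hS hm.le
    _ ≤ (ψ e).re := hnr
    _ = ((wilsonDirac ρ U m 1)⁻¹ e e).re := rfl

/-- Norm form: `m/(m+8)² ≤ ‖(D_W(U,m,1)⁻¹)_{ee}‖` for `m > 0`, every gauge field. [folklore] -/
theorem norm_inv_wilsonDirac_apply_self_ge (hρ : ∀ g, ρ g ∈ Matrix.unitaryGroup (Fin N) ℂ)
    (U : GaugeConfig 4 L G) {m : ℝ} (hm : 0 < m) (e : TorusSite 4 L × Fin N × Fin 4) :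
    m / (m + 8) ^ 2 ≤ ‖(wilsonDirac ρ U m 1)⁻¹ e e‖ :=
  (re_inv_wilsonDirac_apply_self_ge ρ hρ U hm e).trans (Complex.re_le_norm _)

/-- **The same-site colour–spin block of the propagator is bounded below, configuration-wise**:
`4N · m/(m+8)² ≤ Σ_{a,i,b,j} ‖(D_W(U,m,1)⁻¹)_{(x,a,i),(x,b,j)}‖` for `m > 0` (diagonal terms only).
[folklore] -/
theorem diag_blockSum_norm_inv_wilsonDirac_ge (hρ : ∀ g, ρ g ∈ Matrix.unitaryGroup (Fin N) ℂ)
    (U : GaugeConfig 4 L G) {m : ℝ} (hm : 0 < m) (x : TorusSite 4 L) :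
    4 * (N : ℝ) * (m / (m + 8) ^ 2) ≤ ∑ a : Fin N, ∑ i : Fin 4, ∑ b : Fin N, ∑ j : Fin 4,
      ‖(wilsonDirac ρ U m 1)⁻¹ (x, a, i) (x, b, j)‖ := by
  have hdiag : ∀ (a : Fin N) (i : Fin 4),
      m / (m + 8) ^ 2 ≤ ‖(wilsonDirac ρ U m 1)⁻¹ (x, a, i) (x, a, i)‖ := fun a i =>
    norm_inv_wilsonDirac_apply_self_ge ρ hρ U hm (x, a, i)
  calc 4 * (N : ℝ) * (m / (m + 8) ^ 2) = ∑ _a : Fin N, ∑ _i : Fin 4, m / (m + 8) ^ 2 := by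
        simp only [Finset.sum_const, Finset.card_univ, Fintype.card_fin, nsmul_eq_mul]
        push_cast
        ring
    _ ≤ ∑ a : Fin N, ∑ i : Fin 4, ‖(wilsonDirac ρ U m 1)⁻¹ (x, a, i) (x, a, i)‖ :=
        Finset.sum_le_sum fun a _ => Finset.sum_le_sum fun i _ => hdiag a i
    _ ≤ _ := by
        refine Finset.sum_le_sum fun a _ => Finset.sum_le_sum fun i _ => ?_
        calc ‖(wilsonDirac ρ U m 1)⁻¹ (x, a, i) (x, a, i)‖
            ≤ ∑ j : Fin 4, ‖(wilsonDirac ρ U m 1)⁻¹ (x, a, i) (x, a, j)‖ :=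
              Finset.single_le_sum
                (f := fun j : Fin 4 => ‖(wilsonDirac ρ U m 1)⁻¹ (x, a, i) (x, a, j)‖)
                (fun _ _ => norm_nonneg _) (Finset.mem_univ i)
          _ ≤ ∑ b : Fin N, ∑ j : Fin 4, ‖(wilsonDirac ρ U m 1)⁻¹ (x, a, i) (x, b, j)‖ :=
              Finset.single_le_sum
                (f := fun b : Fin N => ∑ j : Fin 4, ‖(wilsonDirac ρ U m 1)⁻¹ (x, a, i) (x, b, j)‖)
                (fun _ _ => Finset.sum_nonneg fun _ _ => norm_nonneg _) (Finset.mem_univ a)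

end Torus

/-! ### §2 The `n = 0` entry of the lower pin at positive bare masses -/

/-- **The same-site phase-quenched fractional moment is bounded below at positive bare masses,
uniformly in the coupling and the volume** (tree vocabulary): for bare
masses `m_g > 0` (all flavours), every `β`, every torus of side `2S+1`, every flavour `f` and every
exponent `s ≥ 0`,
`(12 m_f/(m_f+8)²)^s ≤ E_{|w|,β,S}[(Σ_{a,i,b,j}|G_f((0,a,i),(0,b,j))|)^s]`.
Configuration-wise bound `diag_blockSum_norm_inv_wilsonDirac_ge` (after the flavour reduction
`inv_diracMatrix_apply_same_flavour`) integrated against the positive weight `|det D(U)|`, which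
never vanishes at positive masses (`det_diracMatrix_ne_zero_of_pos`,
`integral_norm_det_diracMatrix_pos_of_exists`). [folklore] -/
theorem phaseQuenched_diagMoment_ge_of_pos (Nf : ℕ) (β : ℝ) (mq : Fin Nf → ℝ)
    (hpos : ∀ g, 0 < mq g) (S : ℕ) (f : Fin Nf) {s : ℝ} (hs : 0 ≤ s) :
    (12 * (mq f / (mq f + 8) ^ 2)) ^ s ≤
      (∫ U : GaugeConfig 4 (2 * S + 1) (Matrix.specialUnitaryGroup (Fin 3) ℂ),
          ‖(diracMatrix U mq).det‖ *
            (∑ a : Fin 3, ∑ i : Fin 4, ∑ b : Fin 3, ∑ j : Fin 4,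
              ‖(diracMatrix U mq)⁻¹ (quarkEquiv (f, (Torus.proj (2 * S + 1) 0, a, i)))
                (quarkEquiv (f, (Torus.proj (2 * S + 1) 0, b, j)))‖) ^ s
          ∂(wilsonMeasure (fundamentalRep (Fin 3)) β)) /
        (∫ U : GaugeConfig 4 (2 * S + 1) (Matrix.specialUnitaryGroup (Fin 3) ℂ),
          ‖(diracMatrix U mq).det‖ ∂(wilsonMeasure (fundamentalRep (Fin 3)) β)) := by
  set c : ℝ := 12 * (mq f / (mq f + 8) ^ 2) with hc
  have hc0 : 0 ≤ c := by have := hpos f; positivity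
  set X : GaugeConfig 4 (2 * S + 1) SU3 → ℝ := fun U =>
    ∑ a : Fin 3, ∑ i : Fin 4, ∑ b : Fin 3, ∑ j : Fin 4,
      ‖(diracMatrix U mq)⁻¹ (quarkEquiv (f, (Torus.proj (2 * S + 1) 0, a, i)))
        (quarkEquiv (f, (Torus.proj (2 * S + 1) 0, b, j)))‖ with hX
  -- one-flavour and full determinants never vanish at positive masses
  have hdetW : ∀ (U : GaugeConfig 4 (2 * S + 1) SU3) (g : Fin Nf),
      (wilsonDirac (fundamentalRep (Fin 3)) U (mq g) 1).det ≠ 0 := fun U g =>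
    wilsonDirac_det_ne_zero_of_pos (fundamentalRep (Fin 3)) fundamentalRep_mem_unitaryGroup U (hpos g)
  have hdet : ∀ U : GaugeConfig 4 (2 * S + 1) SU3, (diracMatrix U mq).det ≠ 0 := fun U =>
    det_diracMatrix_ne_zero_of_pos U mq hpos
  have hZ : 0 < ∫ U : GaugeConfig 4 (2 * S + 1) SU3, ‖(diracMatrix U mq).det‖
      ∂(wilsonMeasure (fundamentalRep (Fin 3)) β) :=
    integral_norm_det_diracMatrix_pos_of_exists β mq ⟨fun _ => 1, hdet _⟩
  -- configuration-wise lower bound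
  have hXge : ∀ U, c ≤ X U := by
    intro U
    have h := diag_blockSum_norm_inv_wilsonDirac_ge (fundamentalRep (Fin 3))
      fundamentalRep_mem_unitaryGroup U (hpos f) (Torus.proj (2 * S + 1) 0)
    have hX' : X U = ∑ a : Fin 3, ∑ i : Fin 4, ∑ b : Fin 3, ∑ j : Fin 4,
        ‖(wilsonDirac (fundamentalRep (Fin 3)) U (mq f) 1)⁻¹ (Torus.proj (2 * S + 1) 0, a, i)
          (Torus.proj (2 * S + 1) 0, b, j)‖ := by
      simp only [hX, inv_diracMatrix_apply_same_flavour U mq (hdetW U) f]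
    rw [hX']
    calc c = 4 * ((3 : ℕ) : ℝ) * (mq f / (mq f + 8) ^ 2) := by rw [hc]; norm_num
      _ ≤ _ := h
  have hX0 : ∀ U, 0 ≤ X U := fun U => hc0.trans (hXge U)
  -- configuration-wise upper bound (integrability only): the heavy bound at the lightest flavour
  obtain ⟨g₀, -, hg₀⟩ := Finset.exists_min_image Finset.univ mq ⟨f, Finset.mem_univ f⟩
  have hm₀ : 0 < mq g₀ := hpos g₀
  have hM : ∀ g, mq g₀ ≤ mq g := fun g => hg₀ g (Finset.mem_univ g)
  have hXle : ∀ U, X U ≤ 144 * (mq g₀)⁻¹ := by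
    intro U
    have hentry : ∀ (a : Fin 3) (i : Fin 4) (b : Fin 3) (j : Fin 4),
        ‖(diracMatrix U mq)⁻¹ (quarkEquiv (f, (Torus.proj (2 * S + 1) 0, a, i)))
          (quarkEquiv (f, (Torus.proj (2 * S + 1) 0, b, j)))‖ ≤ (mq g₀)⁻¹ := by
      intro a i b j
      refine (norm_inv_diracMatrix_apply_le_of_le U mq hm₀ hM f _ _ 0).trans ?_
      have hθ0 : 0 ≤ 4 / (mq g₀ + 4) := by positivity
      have hθ1 : 4 / (mq g₀ + 4) ≤ 1 := by rw [div_le_one (by linarith)]; linarith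
      calc (mq g₀)⁻¹ * (4 / (mq g₀ + 4)) ^ _ ≤ (mq g₀)⁻¹ * 1 :=
            mul_le_mul_of_nonneg_left (pow_le_one₀ hθ0 hθ1) (inv_nonneg.2 hm₀.le)
        _ = (mq g₀)⁻¹ := mul_one _
    calc X U ≤ ∑ _a : Fin 3, ∑ _i : Fin 4, ∑ _b : Fin 3, ∑ _j : Fin 4, (mq g₀)⁻¹ :=
          Finset.sum_le_sum fun a _ => Finset.sum_le_sum fun i _ => Finset.sum_le_sum fun b _ =>
            Finset.sum_le_sum fun j _ => hentry a i b j
      _ = 144 * (mq g₀)⁻¹ := by simp; ring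
  -- measurability and integrability of the weighted moment
  have hXm : Measurable X := by
    refine Finset.measurable_sum _ fun a _ => Finset.measurable_sum _ fun i _ =>
      Finset.measurable_sum _ fun b _ => Finset.measurable_sum _ fun j _ => ?_
    exact (measurable_inv_diracMatrix_apply mq _ _).norm
  have hint : Integrable (fun U => ‖(diracMatrix U mq).det‖ * X U ^ s)
      (wilsonMeasure (fundamentalRep (Fin 3)) β) := by
    refine integrable_norm_det_diracMatrix_mul β mq (fun U => X U ^ s)
      ((Real.continuous_rpow_const hs).measurable.comp hXm).aestronglyMeasurable
      (C := (144 * (mq g₀)⁻¹) ^ s) fun U => ?_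
    rw [Real.norm_eq_abs, abs_of_nonneg (Real.rpow_nonneg (hX0 U) _)]
    exact Real.rpow_le_rpow (hX0 U) (hXle U) hs
  -- assemble
  have hnum : (∫ U : GaugeConfig 4 (2 * S + 1) SU3, ‖(diracMatrix U mq).det‖
        ∂(wilsonMeasure (fundamentalRep (Fin 3)) β)) * c ^ s ≤
      ∫ U : GaugeConfig 4 (2 * S + 1) SU3, ‖(diracMatrix U mq).det‖ * X U ^ s
        ∂(wilsonMeasure (fundamentalRep (Fin 3)) β) := by
    rw [← integral_mul_const]
    refine integral_mono_of_nonneg (Eventually.of_forall fun U => ?_) hint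
      (Eventually.of_forall fun U => ?_)
    · exact mul_nonneg (norm_nonneg _) (Real.rpow_nonneg hc0 _)
    · exact mul_le_mul_of_nonneg_left (Real.rpow_le_rpow hc0 (hXge U) hs) (norm_nonneg _)
  show c ^ s ≤ (∫ U : GaugeConfig 4 (2 * S + 1) SU3, ‖(diracMatrix U mq).det‖ * X U ^ s
      ∂(wilsonMeasure (fundamentalRep (Fin 3)) β)) /
    (∫ U : GaugeConfig 4 (2 * S + 1) SU3, ‖(diracMatrix U mq).det‖
      ∂(wilsonMeasure (fundamentalRep (Fin 3)) β))
  rw [le_div_iff₀ hZ]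
  exact (mul_comm _ _).trans_le hnum

end Literature.MathematicalPhysics.QuantumFieldTheory

end
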